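import Summits.BirchSwinnertonDyer.Rank1Residual.GaloisImage.SelmerClassInertia
import Literature.NumberTheory.GaloisRepresentations.GlobalPFinitenessProofs
import HarnessLib

/-!
# Selmer groups of FINITE Galois modules with unramified local conditions outside a finite set are
# finite (cell `b2b-bsdres`, team n1011, ROUTE-1 item R1-56 "S24(1) @ m = 1 in the kernel",
# row T-R1-56-S, FILE F-fin part 2)

HONEST FRAMING (verbatim for the cell): research route; prove what is provable now; no claim beyond
stated classes; nothing booked; no mark / label moved.  TOOL theorems of Galois cohomology;
theorems only: no definition, no named fact, no conjecture node.

## What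

`finite_selmerGroup_of_unramified_outside` — for a FINITE discrete Galois module `M` over a number
field `K`, a finite set `S` of finite places containing the ramification of `M`, and a Selmer
structure `𝓕` with `𝓕_v = H¹_ur(K_v, M)` for `v ∉ S`: **`H¹_𝓕(K, M)` is finite**; and the
`IsUnramifiedOutside` / `Finset (Place K)` reading `finite_selmerGroup_of_isUnramifiedOutside` (the
`hfin` binder of the Kolyvagin-system files; with `M^D` for `M` it is `hfind`).

Proof (Milne *ADT* I §4 / NSW (8.3.20) "`H¹(G_S, M)` is finite", organised through the tree's
restricted-ramification group `N_S` and Hermite's theorem): a Selmer class is represented by a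
crossed homomorphism `f`; `V_f = {g : ρ(g) = 1, f(g) = 0}` is an OPEN NORMAL subgroup of `Γ_K` of
index `≤ [Γ_K : ker ρ] · #M`, containing every inertia group above `v ∉ S` (FILE F-fin part 1), hence
`N_S ≤ V_f`; such subgroups are FINITELY many (`finite_setOf_isOpen_normal_ramificationSubgroup_le`,
Hermite); and `f` factors through the finite quotient `Γ_K / V_f`, so the crossed homomorphisms —
hence the classes — are finitely many.

References: J. S. Milne, *Arithmetic Duality Theorems* (2006), Ch. I §4 (Lemma 4.8 ff.);
J. Neukirch, A. Schmidt, K. Wingberg, *Cohomology of Number Fields* (2008), (8.3.20);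
B. Mazur, in *Galois groups over ℚ* (1989), §1.2 (`Φ_p` for `G_{K,S}`).
-/

noncomputable section

open scoped NumberField Pointwise
open Function Field NumberField IsDedekindDomain
open Literature.NumberTheory.GaloisRepresentations Literature.NumberTheory.GaloisRepresentations.DiscreteGaloisModule

universe u

namespace Summit.BirchSwinnertonDyer.Rank1Residual.GaloisImage.SelmerFinite

variable {K : Type u} [Field K] [NumberField K]
variable {M : Type u} [AddCommGroup M] [TopologicalSpace M] [DiscreteTopology M]
variable (ρ : DiscreteGaloisModule K M)

/-! ## §1. The open normal subgroup `V_f = {ρ = 1, f = 0}` of a crossed homomorphism -/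

omit [NumberField K] in
/-- `f(g⁻¹) = 0` when `ρ(g) = 1` and `f(g) = 0`. [folklore] -/
theorem apply_inv_eq_zero (f : contOneCocycles ρ.toTopRep) {g : absoluteGaloisGroup K}
    (hg : ρ g = 1) (hfg : f.1 g = 0) : f.1 g⁻¹ = 0 := by
  have h := f.2 g g⁻¹
  rw [mul_inv_cancel, contOneCocycles.apply_one] at h
  change (0 : M) = f.1 g + ρ g (f.1 g⁻¹) at h
  rw [hfg, zero_add, hg, Module.End.one_apply] at h
  exact h.symm

omit [NumberField K] in
/-- The subset `V_f = {g : ρ(g) = 1 ∧ f(g) = 0}` is a subgroup; packaged as: there is a subgroup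
with exactly this carrier. [folklore] -/
theorem exists_subgroup_carrier_eq (f : contOneCocycles ρ.toTopRep) :
    ∃ V : Subgroup (absoluteGaloisGroup K), (V : Set (absoluteGaloisGroup K)) = {g | ρ g = 1 ∧ f.1 g = 0} := by
  refine ⟨{ carrier := {g | ρ g = 1 ∧ f.1 g = 0}
            mul_mem' := fun {a b} ha hb => ⟨by rw [map_mul, ha.1, hb.1, mul_one], ?_⟩
            one_mem' := ⟨map_one ρ, contOneCocycles.apply_one f⟩
            inv_mem' := fun {a} ha =>
              ⟨by
                  have h1 : ρ (a⁻¹ * a) = 1 := by rw [inv_mul_cancel, map_one]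
                  rwa [map_mul, ha.1, mul_one] at h1,
                apply_inv_eq_zero ρ f ha.1 ha.2⟩ }, rfl⟩
  have h := f.2 a b
  change f.1 (a * b) = f.1 a + ρ a (f.1 b) at h
  rw [h, ha.2, hb.2, map_zero, add_zero]

omit [NumberField K] in
/-- `{g : ρ(g) = 1}` is open for a finite discrete module. [folklore] -/
theorem isOpen_setOf_apply_eq_one [Finite M] : IsOpen {g : absoluteGaloisGroup K | ρ g = 1} := by
  have h : {g : absoluteGaloisGroup K | ρ g = 1} = ⋂ m : M, {g | ρ g m = m} := by
    ext g
    simp only [Set.mem_setOf_eq, Set.mem_iInter]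
    exact ⟨fun hg m => by rw [hg, Module.End.one_apply], fun hg => LinearMap.ext hg⟩
  rw [h]
  exact isOpen_iInter_of_finite fun m => ρ.isOpen_setOf_apply_eq m

/-! ## §2. Finiteness -/

/-- **`H¹_𝓕(K, M)` is finite for a finite module with unramified local conditions outside a finite
set `S ⊇ Ram(M)` of finite places** (Milne *ADT* I §4; NSW (8.3.20)). [folklore] -/
theorem finite_selmerGroup_of_unramified_outside [Finite M] {S : Set (HeightOneSpectrum (𝓞 K))}
    (hS : S.Finite) (hunr : ∀ v ∉ S, GaloisRep.IsUnramifiedAt v ρ) {𝓕 : SelmerStructure ρ}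
    (h𝓕 : ∀ v ∉ S, 𝓕 (Sum.inr v) = unramifiedSubgroup (GaloisRep.toLocal v ρ) 1) :
    Finite 𝓕.selmerGroup := by
  classical
  -- the open subgroup `U₀ = ker ρ` and the index bound `n`
  obtain ⟨U₀, hU₀⟩ := exists_subgroup_carrier_eq ρ 0
  have hU₀mem : ∀ g, g ∈ U₀ ↔ ρ g = 1 := fun g => by
    rw [← SetLike.mem_coe, hU₀]
    exact ⟨fun h => h.1, fun h => ⟨h, rfl⟩⟩
  set n := Nat.card M * U₀.index with hn
  -- the finite set of admissible open normal subgroups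
  set 𝒩 := {N : Subgroup (absoluteGaloisGroup K) | IsOpen (N : Set (absoluteGaloisGroup K)) ∧ N.Normal ∧
      ramificationSubgroup K S ≤ N ∧ N.index ≤ n} with h𝒩
  have h𝒩fin : 𝒩.Finite := finite_setOf_isOpen_normal_ramificationSubgroup_le K hS n
  -- functions factoring through some `N ∈ 𝒩`
  set T : Set (absoluteGaloisGroup K → M) :=
    ⋃ N ∈ 𝒩, Set.range fun ψ : absoluteGaloisGroup K ⧸ N → M => ψ ∘ QuotientGroup.mk with hT
  have hTfin : T.Finite := by
    refine h𝒩fin.biUnion fun N hN => ?_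
    haveI : Finite (absoluteGaloisGroup K ⧸ N) := Subgroup.quotient_finite_of_isOpen N hN.1
    exact Set.finite_range _
  -- every cocycle of a Selmer class lies in `T`
  have hmain : ∀ f : contOneCocycles ρ.toTopRep, oneCocycleClass ρ.toTopRep f ∈ 𝓕.selmerGroup →
      (f.1 : absoluteGaloisGroup K → M) ∈ T := by
    intro f hf
    obtain ⟨V, hV⟩ := exists_subgroup_carrier_eq ρ f
    have hVmem : ∀ g, g ∈ V ↔ ρ g = 1 ∧ f.1 g = 0 := fun g => by rw [← SetLike.mem_coe, hV]; rfl
    -- `V` is open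
    have hVopen : IsOpen (V : Set (absoluteGaloisGroup K)) := by
      rw [hV, Set.setOf_and]
      exact (isOpen_setOf_apply_eq_one ρ).inter
        ((isOpen_discrete ({0} : Set M)).preimage f.1.continuous)
    -- `V` is normal
    haveI hVnormal : V.Normal := ⟨fun h hh g => by
      rw [hVmem] at hh ⊢
      refine ⟨by rw [map_mul, map_mul, hh.1, mul_one, ← map_mul, mul_inv_cancel, map_one], ?_⟩
      rw [apply_conj_eq_of_apply_eq_one ρ f hh.1, hh.2, map_zero]⟩
    -- `N_S ≤ V`
    have hNS : ramificationSubgroup K S ≤ V := by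
      have hker : (QuotientGroup.mk' V).ker = V := QuotientGroup.ker_mk' V
      have h := ramificationSubgroup_le_ker (S := S) (QuotientGroup.mk' V) (by rw [hker]; exact hVopen)
        (fun v hv 𝔓 h𝔓 σ hσ => by
          rw [← MonoidHom.mem_ker, hker, hVmem]
          exact ⟨hunr v hv 𝔓 h𝔓 σ hσ,
            apply_eq_zero_of_mem_inertia_of_mem_selmerGroup ρ (hunr v hv) (h𝓕 v hv) f hf 𝔓 h𝔓 σ hσ⟩)
      rwa [hker] at h
    -- index bound: `V ≤ U₀`, `[U₀ : V] ≤ #M` via the homomorphism `u ↦ f(u)` on `U₀`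
    have hVU : V ≤ U₀ := fun g hg => (hU₀mem g).mpr ((hVmem g).mp hg).1
    have hindex : V.index ≤ n := by
      let φ : U₀ →* Multiplicative M :=
        { toFun := fun u => Multiplicative.ofAdd (f.1 u)
          map_one' := by rw [OneMemClass.coe_one, contOneCocycles.apply_one]; rfl
          map_mul' := fun a b => by
            have h := f.2 a b
            change f.1 (a * b) = f.1 a + ρ a (f.1 b) at h
            rw [← ofAdd_add, Subgroup.coe_mul, h, (hU₀mem a).mp a.2, Module.End.one_apply] }
      have hkerφ : φ.ker = V.subgroupOf U₀ := by
        ext u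
        rw [MonoidHom.mem_ker, Subgroup.mem_subgroupOf, hVmem]
        change Multiplicative.ofAdd (f.1 u) = 1 ↔ _
        rw [ofAdd_eq_one]
        exact ⟨fun h => ⟨(hU₀mem u).mp u.2, h⟩, fun h => h.2⟩
      have hrel : V.relIndex U₀ ≤ Nat.card M := by
        rw [Subgroup.relIndex, ← hkerφ, Subgroup.index_ker]
        exact Nat.card_le_card_of_injective (fun x : φ.range => (x : Multiplicative M))
          Subtype.val_injective
      rw [← Subgroup.relIndex_mul_index hVU, hn]
      exact Nat.mul_le_mul_right _ hrel
    -- so `V ∈ 𝒩`, and `f` factors through `Γ_K / V`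
    have hV𝒩 : V ∈ 𝒩 := ⟨hVopen, hVnormal, hNS, hindex⟩
    refine Set.mem_biUnion hV𝒩 ⟨fun q => f.1 q.out, funext fun g => ?_⟩
    change f.1 (QuotientGroup.mk g : absoluteGaloisGroup K ⧸ V).out = f.1 g
    obtain ⟨v, hv⟩ := QuotientGroup.mk_out_eq_mul V g
    rw [hv]
    have h := f.2 g v
    change f.1 (g * v) = f.1 g + ρ g (f.1 v) at h
    rw [h, ((hVmem v).mp v.2).2, map_zero, add_zero]
  -- conclude: classes inject into the finite set `T` through chosen cocycles
  haveI : Finite T := hTfin.to_subtype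
  refine Finite.of_injective (fun c : 𝓕.selmerGroup =>
    (⟨((oneCocycleClass_surjective ρ.toTopRep c.1).choose.1 : absoluteGaloisGroup K → M),
      hmain _ (by rw [(oneCocycleClass_surjective ρ.toTopRep c.1).choose_spec]; exact c.2)⟩ : T))
    fun c c' h => ?_
  have h' : ((oneCocycleClass_surjective ρ.toTopRep c.1).choose.1 : absoluteGaloisGroup K → M) =
      (oneCocycleClass_surjective ρ.toTopRep c'.1).choose.1 := congrArg Subtype.val h
  have hcoc : (oneCocycleClass_surjective ρ.toTopRep c.1).choose =
      (oneCocycleClass_surjective ρ.toTopRep c'.1).choose :=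
    Subtype.ext (ContinuousMap.ext fun g => congrFun h' g)
  apply Subtype.ext
  rw [← (oneCocycleClass_surjective ρ.toTopRep c.1).choose_spec,
    ← (oneCocycleClass_surjective ρ.toTopRep c'.1).choose_spec, hcoc]

/-- The `Finset (Place K)` / `IsUnramifiedOutside` reading (the `hfin` binder of the Kolyvagin-system
files): for a finite discrete module unramified outside `S` and a Selmer structure unramified outside
`S`, `H¹_𝓕(K, M)` is finite. [folklore] -/
theorem finite_selmerGroup_of_isUnramifiedOutside [Finite M] {S : Finset (Place K)}
    (hS : ∀ v : HeightOneSpectrum (𝓞 K), (Sum.inr v : Place K) ∉ S → GaloisRep.IsUnramifiedAt v ρ)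
    {𝓕 : SelmerStructure ρ} (h𝓕 : 𝓕.IsUnramifiedOutside S) : Finite 𝓕.selmerGroup := by
  refine finite_selmerGroup_of_unramified_outside ρ (S := {v | (Sum.inr v : Place K) ∈ S})
    ((S.finite_toSet.preimage Sum.inr_injective.injOn).subset fun v hv => hv) (fun v hv => hS v hv)
    fun v hv => h𝓕.2 v hv

end Summit.BirchSwinnertonDyer.Rank1Residual.GaloisImage.SelmerFinite

end
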